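import Literature.MathematicalPhysics.QuantumLattice.EmeryThreeBandCuO4WindowFloor
import Literature.MathematicalPhysics.QuantumLattice.EmeryThreeBandWindowFloors
import Literature.MathematicalPhysics.QuantumLattice.EmeryThreeBandStatesNonempty
import HarnessLib

/-!
# Three-band cluster floors, SIDE-CONDITION-FREE: every window containing the `CuO₄` plus fits, and the class is nonempty on `0 ≤ ρ ≤ 3/2`

Topic `Literature/MathematicalPhysics/QuantumLattice` (family `hubbard`; crew hubbard-fast S2 (iv) «three-band Emery boxes»). The Emery cluster floor
`le_emeryEnergyDensity_of_posSemidef_uniform` carries two side conditions besides the certificate: the window's covering hypothesis `hfit` and the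
nonemptiness of the variational class. `EmeryThreeBandCuO4WindowFloor` (hubbard-downfold-mod-4) discharges `hfit` for the 5-site plus `W₅`,
`EmeryThreeBandWindowFloors` (this seat) shows `hfit` is monotone in the window, `EmeryThreeBandStatesNonempty` (this seat) shows the class is nonempty
iff `0 ≤ ρ ≤ 3/2`. Composition:

* `emeryWindow_fit_of_cuO4_subset`: EVERY window `B ⊇ W₅` fits (`Cu₂O₄ = W₅ + {(0,2)}` or `+ {(4,2)}` — 6 orbitals, largest spin sector `400`;
  `Cu₂O₇`; the `2×2`-cell block; …), for every `θ`;
* `le_emeryEnergyDensity_of_cuO4WindowCertificate`: the turnkey floor on any `B ⊇ W₅` (nonempty class as hypothesis);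
* **`le_emeryEnergyDensity_of_cuO4WindowCertificate'`**, **`le_emeryEnergyDensity_of_cuO4Certificate'`**, `le_emeryEnergyDensity_of_ringCertificate'`:
  the same floors with the class hypothesis replaced by `0 ≤ ρ ≤ 3/2` — NO side condition left but the certificate and the filling range.

Everything is PROVED (0 sorry); no definition, no named fact, no number.

## Tree / Mathlib search

REUSED: `emeryCuO4Window(_fit)`, `le_emeryEnergyDensity_of_cuO4Certificate` (`EmeryThreeBandCuO4WindowFloor`); `periodicFit_mono` (`EmeryThreeBandWindowFloors`);
`le_emeryEnergyDensity_of_ringCertificate` (`EmeryThreeBandRingWindowFloor`); `emeryStates_nonempty` (`EmeryThreeBandStatesNonempty`);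
`le_emeryEnergyDensity_of_posSemidef_uniform`, `uniformPeriodicWeight` (`WeightedOpenClusterUniformWeightsPeriodic`).

## References

* P. W. Anderson, Phys. Rev. 83 (1951) 1260, eq. (2). [cite: Anderson1951, eq. (2)]
* R. Valentí, J. Stolze, P. J. Hirschfeld, Phys. Rev. B 43 (1991) 13743, §II. [cite: ValentiStolzeHirschfeld1991, §II]
* H. Araki, H. Moriya, Rev. Math. Phys. 15 (2003) 93, §11.1 Thm. 11.2. [cite: ArakiMoriya2003, §11.1 Theorem 11.2]
-/

noncomputable section

open scoped ComplexOrder BigOperators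
open Finset

namespace Literature.MathematicalPhysics.QuantumLattice

open Matrix HubbardWave0 Literature.Probability.LatticeModels ThermodynamicLimit
open scoped Matrix.Norms.L2Operator

/-- **Every window containing the `CuO₄` plus fits the three-band interaction**, for every coupling vector. [cite: ValentiStolzeHirschfeld1991, §II] -/
theorem emeryWindow_fit_of_cuO4_subset (θ : Fin 14 → ℝ) {B : Finset (Site 2)} (hB : emeryCuO4Window ⊆ B) :
    ∀ (c : Cell liebPeriods) (X : Finset (Site 2)), cellPos c ∈ X → (emeryInteraction θ).Φ X ≠ 0 →
      ∃ v : Site 2, InCoset liebPeriods 0 v ∧ shiftSet v X ⊆ B :=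
  periodicFit_mono hB (emeryCuO4Window_fit θ)

namespace InfVolFermionState

/-- **TURNKEY EMERY FLOOR ON ANY WINDOW CONTAINING THE PLUS** (`B ⊇ W₅` finite; e.g. the 6-orbital `Cu₂O₄`): a certificate
`H^{w}_B[emeryInteraction θ] + G − q₀·1 ⪰ 0` with the uniform `(2ℤ)²`-weight of `B` of mass `M > 0` and `G` killed by `2×2`-periodic states gives
`q₀/(4M) ≤ emeryEnergyDensity θ ρ` (nonempty class). [cite: Anderson1951, eq. (2)] [cite: ValentiStolzeHirschfeld1991, §II] -/
theorem le_emeryEnergyDensity_of_cuO4WindowCertificate (θ : Fin 14 → ℝ) {ρ : ℝ} (hS : (emeryStates ρ).Nonempty) {B : Finset (Site 2)}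
    (hB : emeryCuO4Window ⊆ B) {M : ℝ} (hM : 0 < M)
    {G : FermionOp B} (hG0 : ∀ ω' : InfVolFermionState 2, ω'.IsPeriodic liebPeriods → (ω'.expect B G).re = 0) {q₀ : ℝ}
    (hq : ((⟨fun X => (uniformPeriodicWeight liebPeriods B M X : ℂ) • (emeryInteraction θ).Φ X⟩ : FermionInteraction 2).localHamiltonian B + G -
      (q₀ : ℂ) • (1 : FermionOp B)).PosSemidef) :
    q₀ / (4 * M) ≤ emeryEnergyDensity θ ρ :=
  le_emeryEnergyDensity_of_posSemidef_uniform θ hS B hM (emeryWindow_fit_of_cuO4_subset θ hB) hG0 hq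

/-- **The same, with NO class hypothesis**: for `0 ≤ ρ ≤ 3/2` the class is inhabited (`emeryStates_nonempty`). [cite: Anderson1951, eq. (2)]
[cite: ArakiMoriya2003, §11.1 Theorem 11.2] -/
theorem le_emeryEnergyDensity_of_cuO4WindowCertificate' (θ : Fin 14 → ℝ) {ρ : ℝ} (hρ0 : 0 ≤ ρ) (hρ1 : ρ ≤ 3 / 2) {B : Finset (Site 2)}
    (hB : emeryCuO4Window ⊆ B) {M : ℝ} (hM : 0 < M)
    {G : FermionOp B} (hG0 : ∀ ω' : InfVolFermionState 2, ω'.IsPeriodic liebPeriods → (ω'.expect B G).re = 0) {q₀ : ℝ}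
    (hq : ((⟨fun X => (uniformPeriodicWeight liebPeriods B M X : ℂ) • (emeryInteraction θ).Φ X⟩ : FermionInteraction 2).localHamiltonian B + G -
      (q₀ : ℂ) • (1 : FermionOp B)).PosSemidef) :
    q₀ / (4 * M) ≤ emeryEnergyDensity θ ρ :=
  le_emeryEnergyDensity_of_cuO4WindowCertificate θ (emeryStates_nonempty hρ0 hρ1) hB hM hG0 hq

/-- **The plus floor with NO class hypothesis** (`0 ≤ ρ ≤ 3/2`). [cite: Anderson1951, eq. (2)] [cite: ArakiMoriya2003, §11.1 Theorem 11.2] -/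
theorem le_emeryEnergyDensity_of_cuO4Certificate' (θ : Fin 14 → ℝ) {ρ : ℝ} (hρ0 : 0 ≤ ρ) (hρ1 : ρ ≤ 3 / 2) {M : ℝ} (hM : 0 < M)
    {G : FermionOp emeryCuO4Window} (hG0 : ∀ ω' : InfVolFermionState 2, ω'.IsPeriodic liebPeriods → (ω'.expect emeryCuO4Window G).re = 0)
    {q₀ : ℝ}
    (hq : ((⟨fun X => (uniformPeriodicWeight liebPeriods emeryCuO4Window M X : ℂ) • (emeryInteraction θ).Φ X⟩ : FermionInteraction 2).localHamiltonian
      emeryCuO4Window + G - (q₀ : ℂ) • (1 : FermionOp emeryCuO4Window)).PosSemidef) :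
    q₀ / (4 * M) ≤ emeryEnergyDensity θ ρ :=
  le_emeryEnergyDensity_of_cuO4Certificate θ (emeryStates_nonempty hρ0 hρ1) hM hG0 hq

/-- **The ring floor with NO class hypothesis** (`0 ≤ ρ ≤ 3/2`). [cite: Anderson1951, eq. (2)] [cite: ArakiMoriya2003, §11.1 Theorem 11.2] -/
theorem le_emeryEnergyDensity_of_ringCertificate' (θ : Fin 14 → ℝ) {ρ : ℝ} (hρ0 : 0 ≤ ρ) (hρ1 : ρ ≤ 3 / 2) {M : ℝ} (hM : 0 < M)
    {G : FermionOp emeryRingWindow} (hG0 : ∀ ω' : InfVolFermionState 2, ω'.IsPeriodic liebPeriods → (ω'.expect emeryRingWindow G).re = 0)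
    {q₀ : ℝ}
    (hq : ((⟨fun X => (uniformPeriodicWeight liebPeriods emeryRingWindow M X : ℂ) • (emeryInteraction θ).Φ X⟩ : FermionInteraction 2).localHamiltonian
      emeryRingWindow + G - (q₀ : ℂ) • (1 : FermionOp emeryRingWindow)).PosSemidef) :
    q₀ / (4 * M) ≤ emeryEnergyDensity θ ρ :=
  le_emeryEnergyDensity_of_ringCertificate θ (emeryStates_nonempty hρ0 hρ1) hM hG0 hq

end InfVolFermionState

end Literature.MathematicalPhysics.QuantumLattice

end
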